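import Literature.NumberTheory.EllipticCurves.Selmer
import Literature.NumberTheory.EllipticCurves.SelmerCorankHolds
import Literature.NumberTheory.EllipticCurves.LFunctionSmulProofs
import Literature.NumberTheory.EllipticCurves.BSDInvariantsProofs
import Literature.NumberTheory.EllipticCurves.GlobalMinimalModelProofs
import HarnessLib

/-!
# BirchSwinnertonDyer — no excess rank from a ONE-PRIME SELMER CAP and the Gross–Zagier–Kolyvagin
# cell (route-independent glue for the split of crux `SqueezeUBR2`, stmt-BirchSwinnertonDyer-0145)

ROUTE-INDEPENDENT module (imports no `Theses` file), so that its main theorem can be cited INSIDE a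
route file as the `--glue-by` of a split (a module importing the route file cannot: cyclic import).

`squeezeUB_of_selmerCapAtOnePrime_of_rankLeOne_statement`: the two statements
* (Sub₁) every globally minimal elliptic `W/ℚ` with `2 ≤ ord_{s=1} L(W,s)` has SOME prime `p` with
  `corank_{ℤ_p} Sel_{p^∞}(W/ℚ) ≤ ord_{s=1} L(W,s)` (verbatim the crux
  `PadicCornerSqueeze.SelmerCapAtOnePrime`, stmt-BirchSwinnertonDyer-19215), and
* (Sub₂) `ord_{s=1} L(W,s) ≤ 1 ⇒ ord_{s=1} L(W,s) = rank_ℤ W(ℚ)` (verbatim `PlecticLegs.RankLeOne`,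
  stmt-BirchSwinnertonDyer-17525; Gross–Zagier 1986 + Kolyvagin 1990, a theorem in print)
imply `rank_ℤ W(ℚ) ≤ ord_{s=1} L(W,s)` for every elliptic `W/ℚ` (verbatim the crux
`LeadingTerm.SqueezeUBR2` = `Squeeze.SqueezeUB` = `HigherGrossZagier.SqueezeUB`).
Proof: case `r_an ≤ 1` by Sub₂; case `2 ≤ r_an` on a global minimal model `C • W`
(`hasGlobalMinimalModel_rat_holds`) by the Kummer bound `rank ≤ corank Sel_{p^∞}` (corank identity
`selmerCorank_eq_mordellWeilRank_add_holds`, Greenberg LNM 1716 §1) at the prime of Sub₁, transported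
back along `C` (`mordellWeilRank_variableChange_holds`, `analyticRank_smul`).
-/

set_option linter.dupNamespace false

namespace Summit.BirchSwinnertonDyer.BirchSwinnertonDyer.Theorems

open WeierstrassCurve

/-- **No excess rank from (Sub₁) a one-prime Selmer cap for `r_an ≥ 2` and (Sub₂) the
Gross–Zagier–Kolyvagin cell `r_an ≤ 1`** — stated over raw statements (no route constants), so
that a route file may cite it as split glue. [folklore] -/
theorem squeezeUB_of_selmerCapAtOnePrime_of_rankLeOne_statement :
    (∀ (W : WeierstrassCurve ℚ) [W.IsElliptic] [W.IsGloballyMinimal], 2 ≤ W.analyticRank →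
        ∃ (p : ℕ) (_ : Fact p.Prime), W.selmerCorank p ≤ W.analyticRank) →
    (∀ (W : WeierstrassCurve ℚ) [W.IsElliptic], W.analyticRank ≤ 1 →
        W.analyticRank = W.mordellWeilRank) →
    ∀ (W : WeierstrassCurve ℚ) [W.IsElliptic], W.mordellWeilRank ≤ W.analyticRank := by
  intro hCap hGZK W _
  by_cases h1 : W.analyticRank ≤ 1
  · exact (hGZK W h1).symm.le
  · obtain ⟨C, hC⟩ := WeierstrassCurve.hasGlobalMinimalModel_rat_holds W
    have hMW : (C • W).mordellWeilRank = W.mordellWeilRank :=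
      WeierstrassCurve.mordellWeilRank_variableChange_holds W C
    have hAn : (C • W).analyticRank = W.analyticRank := WeierstrassCurve.analyticRank_smul W C
    have h2 : 2 ≤ (C • W).analyticRank := by
      rw [hAn]; omega
    obtain ⟨p, hp, hcap⟩ := hCap (C • W) h2
    have hid := (C • W).selmerCorank_eq_mordellWeilRank_add_holds p
    have hmin : (C • W).mordellWeilRank ≤ (C • W).analyticRank := by omega
    rw [hMW, hAn] at hmin
    exact hmin

end Summit.BirchSwinnertonDyer.BirchSwinnertonDyer.Theorems
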